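/-
Copyright (c) 2026 the pub-hodgecm-mathlib formalisation cell (harness21).  Prover seat hodgecm-mathlib-K2E3-p03 (g5), Track B «K2-LIT» ∕ h413
(`stmt-HodgeConjecture-24833`), line `K2_E3_EllipticInputs`, road (11-3-split-nsc), leaf (nsc-S-A′) `sig_K2E3GL3PrincipalBlockStandardSpan` (owner K2E3-p25 (g0)),
brick G1 (dealer K2E3-plan (g4) D64), FILE 1 OF 3: THE JACQUET MODULE OF THE PRINCIPAL SERIES OF `GL₂(F)` AS A TORUS MODULE — the exact sequence
`0 → K₀ → r_B i(x ⊠ y) → ℂ → 0` with its two characters.  2026-09-04.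
-/
import Literature.NumberTheory.Automorphic.PrincipalSeriesGL2WeylSymmetry    -- ★ `jacquetData_smul_of_mem`, brings ★ `PrincipalSeriesGL2JacquetOpenCell`, ★ `DetCharInducingDatum`
import Literature.NumberTheory.Automorphic.SmoothInductionNontrivial          -- ★ `exists_mem_fixedPoints_toFun_eq_of_isOpen` (the section supported on `P·K`)
import Literature.NumberTheory.Automorphic.SmoothIndClosedCellNonzero         -- ★ `exists_openSubgroup_forall_unitsComplex_eq_one`
import Literature.NumberTheory.Automorphic.CongruenceSubgroupExpansionGL      -- ★ `nonarchimedeanGroup_gl`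
import Literature.NumberTheory.Automorphic.CMPrincipalSeriesSpherical         -- ★ `rootDeltaChar_eq_one_of_mem_of_isClosed_of_isCompact`
import Literature.NumberTheory.Automorphic.ParabolicSemidirect                -- ★ `continuous_leviProjection`
import Literature.NumberTheory.Automorphic.ParabolicInduction                 -- ★ `isClosed_standardParabolicGL`
import HarnessLib

/-!
# K2_E3 road (h413), leaf (nsc-S-A′), brick G1 (file 1 of 3): the Jacquet module `J = r_B i(x ⊠ y)` of the principal series of `GL₂(F)`
# in the `lastBlockLabel 2` currency — `0 → K₀ → J —ev₁→ ℂ → 0`, the torus acting on `K₀` by `y ⊠ x` and on the quotient by `x ⊠ y`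

Cell `pub/hodgecm-mathlib` (D-0151), Track B, seat K2E3-p03 (g5); leaf owner K2E3-p25 (g0) «=γ» 2026-09-04T08:48:59Z (the GL₂ slot of the leaf speaks
`lastBlockLabel 2`).  `--supports stmt-HodgeConjecture-24833 --as helper`; THEOREMS ONLY (no definition ∕ instance ∕ notation ∕ named fact ∕ `sorry`); never imports
`Cruxes/…/Lines`.  COUNT-NEUTRAL helper.

OBJECTS (all spelled inline).  `P = standardParabolicGL F (lastBlockLabel 2)` (the upper Borel subgroup of `GL₂(F)`), `U` its unipotent radical
(`unipotentRadicalP`), the inducing datum `σ'_{x,y} = ((x ∘ det) ⊠ y) ∘ proj ⊗ δ_P^{1/2}` (★ `DetCharInducingDatum`, `maxParabolicLeviChar F 2 x y`), the principal series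
`i(x ⊠ y) = parabolicIndGL F (lastBlockLabel 2) (𝟙.twist (maxParabolicLeviChar F 2 x y)) = smoothIndRep P σ'_{x,y}` (by `rfl`), its Jacquet module
`J = (restrictUnipotentGL F (lastBlockLabel 2) (i(x ⊠ y))).Coinvariants` with the NORMALISED Levi action `normalizedJacquetGL F (lastBlockLabel 2)`, and the
open-cell part `K₀ = [I_open] = map mk (vanishingOn P σ' (cellLT (lastBlockLabel 2) w₀))`.

THE RESULTS (for `x y : Fˣ →* ℂˣ` with open kernels, i.e. continuous).
* §1 `continuous_unitsCoe_of_isOpen_ker` (open kernel ⇒ continuous), `parabolicIndGL_two_eq_smoothIndRep` (`rfl` bridge).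
* §2 **`exists_evalOne`** — a linear form `E : J → ℂ` with `E [f] = f(1)`; **`evalOne_normalizedJacquetGL`** — `E (r(m) ȳ) = (x ⊠ y)(m) · E ȳ` (the CLOSED-CELL
  exponent); **`mem_ker_evalOne_iff`** — `ker E = K₀`; **`exists_toFun_one_eq_one`** — a section with `f(1) = 1` (so `E ≠ 0`: ★ `exists_mem_fixedPoints_toFun_eq_of_isOpen`
  over an open subgroup on which `σ'` is trivial, ★ `exists_openSubgroup_forall_unitsComplex_eq_one` + `δ^{1/2} = 1` on `P ∩ GL₂(𝒪)`).
* §3 **`normalizedJacquetGL_eq_smul_of_mem_openCell`** — on `K₀` the normalised Levi action is the SWAPPED character: `r(m) ȳ = (y ⊠ x)(m) • ȳ` for `ȳ ∈ K₀` (★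
  `jacquetData_smul_of_mem` with `σ'' = σ'_{y,x}`: `q_F σ'_{x,y}(d₀ ϖ) = σ'_{y,x}(d ϖ)`, ★ `residueFieldCard_mul_detCharDatum_diag_zero_uniformizer` ∕
  `detCharDatum_diag_last_uniformizer`); `openCell_ne_bot` (★ `exists_mem_vanishingOn_mk_ne_zero`), `normalizedJacquetGL_mem_openCell` (stability).
File 2 (`K2E3GL2JacquetModuleDimension`) adds `dim K₀ = 1`, `dim J = 2`; file 3 (`K2E3GL2JacquetExponents`) the exponent multiplicities `mult (i(x ⊠ y)) χ = [χ = x ⊠ y] + [χ = y ⊠ x]` (★ E1a∕E1b).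
[BernsteinZelevinsky1977, Geometrical Lemma 2.12, Thm. 5.2, §7.1; Casselman1995, §6.3, Lemma 7.1.1 (a): «`0 → (w⁻¹σ)δ^{1∕2} → I_N → σδ^{1∕2} → 0`»; Bump1997, §4.5]
HONEST LABEL: HC_CM is proved only modulo the 7 printed citations (2 remaining named inputs: hLiu418 = stmt-HodgeConjecture-24832, h413 = stmt-HodgeConjecture-24833)
until rung 0 closes; count-neutral helper.

## References
* [BernsteinZelevinsky1977] I. N. Bernstein, A. V. Zelevinsky, *Induced representations of reductive 𝔭-adic groups I*, Ann. Sci. ÉNS 10 (1977), Geometrical Lemma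
  2.12, Thm. 5.2, §7.1.
* [Casselman1995] W. Casselman, *Introduction to the theory of admissible representations of 𝔭-adic reductive groups* (draft 1995), §6.3, Lemma 7.1.1.
* [Bump1997] D. Bump, *Automorphic Forms and Representations* (1997), §4.5.
-/

set_option autoImplicit false
set_option linter.dupNamespace false

noncomputable section

open Matrix Literature.LinearAlgebra.Matrix.DiagonalTorus
open scoped MatrixGroups NNReal
open Literature.NumberTheory.Automorphic Literature.NumberTheory.Automorphic.Zelevinsky1980 ValuativeRel

namespace Summit.HodgeConjecture.HodgeConjecture.Cruxes.H413.K2E3GL2JacquetModuleStructure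

universe u

variable {F : Type u} [Field F] [ValuativeRel F] [TopologicalSpace F] [IsNonarchimedeanLocalField F]

/-! ## §1  Open kernels and the `rfl` bridge `i(x ⊠ y) = Ind_P σ'_{x,y}` -/

omit [ValuativeRel F] [IsNonarchimedeanLocalField F] in
/-- A character of `Fˣ` with OPEN kernel is continuous into `ℂ` (it is constant on the cosets of its kernel). [folklore] -/
theorem continuous_unitsCoe_of_isOpen_ker [IsTopologicalRing F] (χ : Fˣ →* ℂˣ) (hχ : IsOpen (χ.ker : Set Fˣ)) :
    Continuous fun t : Fˣ => ((χ t : ℂˣ) : ℂ) := by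
  refine IsLocallyConstant.continuous ((IsLocallyConstant.iff_exists_open _).2 fun t => ?_)
  refine ⟨(fun k => t * k) '' (χ.ker : Set Fˣ), (isOpenMap_mul_left t) _ hχ, ⟨1, χ.ker.one_mem, mul_one t⟩, ?_⟩
  rintro _ ⟨k, hk, rfl⟩
  rw [map_mul, (MonoidHom.mem_ker).1 hk, mul_one]

/-- **`i(x ⊠ y) = Ind_P σ'_{x,y}`** (`parabolicIndGL` IS `smoothIndRep` of the inducing datum, by `rfl`) — the bridge between the leaf's `I₂ x y` and the currency of the
★ GL₂ Jacquet-module files. [cite: BernsteinZelevinsky1977, §2.3] -/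
theorem parabolicIndGL_two_eq_smoothIndRep (x y : Fˣ →* ℂˣ) :
    Representation.parabolicIndGL F (lastBlockLabel 2)
        ((Representation.trivial ℂ (Π a : Bool, GL {i : Fin 2 // lastBlockLabel 2 i = a} F) ℂ).twist (maxParabolicLeviChar F 2 x y)) =
      Representation.smoothIndRep (standardParabolicGL F (lastBlockLabel 2))
        (Representation.twist (((Representation.trivial ℂ (Π a : Bool, GL {i : Fin 2 // lastBlockLabel 2 i = a} F) ℂ).twist (maxParabolicLeviChar F 2 x y)).comp
          (leviProjection F (lastBlockLabel 2))) (rootDeltaChar (standardParabolicGL F (lastBlockLabel 2)))) :=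
  rfl

/-! ## §2  Evaluation at `1` on the Jacquet module: the closed-cell exponent -/

section EvalOne

variable (x y : Fˣ →* ℂˣ)

/-- **Evaluation at `1` descends to the Jacquet module**: a linear form `E` on `J = r_B i(x ⊠ y)` with `E [f] = f(1)` (`(u·f)(1) = f(u) = σ'(u) f(1) = f(1)` for
`u ∈ U`, ★ `detCharDatum_eq_one_of_mem_unipotentRadicalP`). [cite: BernsteinZelevinsky1977, Geometrical Lemma 2.12 (closed orbit)] [cite: Casselman1995, Lemma 7.1.1 (a)] -/
theorem exists_evalOne :
    ∃ E : (Representation.restrictUnipotentGL F (lastBlockLabel 2) (Representation.smoothIndRep (standardParabolicGL F (lastBlockLabel 2))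
        (Representation.twist (((Representation.trivial ℂ (Π a : Bool, GL {i : Fin 2 // lastBlockLabel 2 i = a} F) ℂ).twist (maxParabolicLeviChar F 2 x y)).comp
          (leviProjection F (lastBlockLabel 2))) (rootDeltaChar (standardParabolicGL F (lastBlockLabel 2)))))).Coinvariants →ₗ[ℂ] ℂ,
      ∀ f, E (Representation.Coinvariants.mk _ f) = f.toFun 1 := by
  set σ' := Representation.twist (((Representation.trivial ℂ (Π a : Bool, GL {i : Fin 2 // lastBlockLabel 2 i = a} F) ℂ).twist (maxParabolicLeviChar F 2 x y)).comp
    (leviProjection F (lastBlockLabel 2))) (rootDeltaChar (standardParabolicGL F (lastBlockLabel 2))) with hσ'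
  let ev : Representation.SmoothInd (standardParabolicGL F (lastBlockLabel 2)) σ' →ₗ[ℂ] ℂ :=
    { toFun := fun f => f.toFun 1
      map_add' := fun f g => by rw [Representation.SmoothInd.toFun_add, Pi.add_apply]
      map_smul' := fun c f => by rw [Representation.SmoothInd.toFun_smul, Pi.smul_apply, RingHom.id_apply] }
  have hcomp : ∀ u : ↥(unipotentRadicalP F (lastBlockLabel 2)),
      ev ∘ₗ Representation.restrictUnipotentGL F (lastBlockLabel 2) (Representation.smoothIndRep (standardParabolicGL F (lastBlockLabel 2)) σ') u = ev := by
    intro u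
    refine LinearMap.ext fun f => ?_
    change ((Representation.smoothIndRep (standardParabolicGL F (lastBlockLabel 2)) σ') ((u : ↥(standardParabolicGL F (lastBlockLabel 2))) : GL (Fin 2) F) f).toFun 1 = f.toFun 1
    rw [Representation.toFun_smoothIndRep_apply, one_mul, ← mul_one (((u : ↥(standardParabolicGL F (lastBlockLabel 2))) : GL (Fin 2) F)),
      Representation.SmoothInd.toFun_subgroup_mul]
    have h1 : σ' (u : ↥(standardParabolicGL F (lastBlockLabel 2))) = 1 := detCharDatum_eq_one_of_mem_unipotentRadicalP F 2 x y _ u.2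
    rw [h1, Module.End.one_apply]
  exact ⟨Representation.Coinvariants.lift _ ev hcomp, fun f => Representation.Coinvariants.lift_mk _ _ _ _⟩

/-- **THE CLOSED-CELL EXPONENT**: `E (r(m) ȳ) = (x ⊠ y)(m) · E ȳ` for the NORMALISED Levi action `r = normalizedJacquetGL` (`(m·f)(1) = f(m) = σ'(m) f(1)`,
`σ'(m) = δ^{1/2}(m) (x ⊠ y)(m)`, and `r(m) = δ^{-1/2}(m) · [m·]`). [cite: BernsteinZelevinsky1977, Thm. 5.2 and §7.1] [cite: Casselman1995, Lemma 7.1.1 (a)] -/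
theorem evalOne_normalizedJacquetGL
    {E : (Representation.restrictUnipotentGL F (lastBlockLabel 2) (Representation.smoothIndRep (standardParabolicGL F (lastBlockLabel 2))
        (Representation.twist (((Representation.trivial ℂ (Π a : Bool, GL {i : Fin 2 // lastBlockLabel 2 i = a} F) ℂ).twist (maxParabolicLeviChar F 2 x y)).comp
          (leviProjection F (lastBlockLabel 2))) (rootDeltaChar (standardParabolicGL F (lastBlockLabel 2)))))).Coinvariants →ₗ[ℂ] ℂ}
    (hE : ∀ f, E (Representation.Coinvariants.mk _ f) = f.toFun 1)
    (m : Π a : Bool, GL {i : Fin 2 // lastBlockLabel 2 i = a} F)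
    (z : (Representation.restrictUnipotentGL F (lastBlockLabel 2) (Representation.smoothIndRep (standardParabolicGL F (lastBlockLabel 2))
        (Representation.twist (((Representation.trivial ℂ (Π a : Bool, GL {i : Fin 2 // lastBlockLabel 2 i = a} F) ℂ).twist (maxParabolicLeviChar F 2 x y)).comp
          (leviProjection F (lastBlockLabel 2))) (rootDeltaChar (standardParabolicGL F (lastBlockLabel 2)))))).Coinvariants) :
    E (Representation.normalizedJacquetGL F (lastBlockLabel 2) (Representation.smoothIndRep (standardParabolicGL F (lastBlockLabel 2))
        (Representation.twist (((Representation.trivial ℂ (Π a : Bool, GL {i : Fin 2 // lastBlockLabel 2 i = a} F) ℂ).twist (maxParabolicLeviChar F 2 x y)).comp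
          (leviProjection F (lastBlockLabel 2))) (rootDeltaChar (standardParabolicGL F (lastBlockLabel 2))))) m z) =
      ((maxParabolicLeviChar F 2 x y m : ℂˣ) : ℂ) * E z := by
  obtain ⟨f, rfl⟩ := Representation.Coinvariants.mk_surjective _ z
  rw [Representation.normalizedJacquetGL_mk, map_smul, hE, hE, smul_eq_mul, Representation.toFun_smoothIndRep_apply, one_mul,
    show blockDiagonalGL F (lastBlockLabel 2) m = ((leviEmbeddingP F (lastBlockLabel 2) m : ↥(standardParabolicGL F (lastBlockLabel 2))) : GL (Fin 2) F) from rfl,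
    ← mul_one (((leviEmbeddingP F (lastBlockLabel 2) m : ↥(standardParabolicGL F (lastBlockLabel 2))) : GL (Fin 2) F)),
    Representation.SmoothInd.toFun_subgroup_mul, detCharDatum_apply, leviProjection_leviEmbeddingP_apply, ← mul_assoc, ← mul_assoc, ← Units.val_mul,
    inv_mul_cancel, Units.val_one, one_mul]

/-- **`ker E = K₀`**: the class of `f` is killed by `E` iff it is the class of a section vanishing on the closed cell `P` (`f(1) = 0 ⇒ f ∈ I_open` ★
`mem_vanishingOn_of_toFun_one_eq_zero`; conversely `1 ∈ P`). [cite: BernsteinZelevinsky1977, §7.1] -/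
theorem mem_ker_evalOne_iff
    {E : (Representation.restrictUnipotentGL F (lastBlockLabel 2) (Representation.smoothIndRep (standardParabolicGL F (lastBlockLabel 2))
        (Representation.twist (((Representation.trivial ℂ (Π a : Bool, GL {i : Fin 2 // lastBlockLabel 2 i = a} F) ℂ).twist (maxParabolicLeviChar F 2 x y)).comp
          (leviProjection F (lastBlockLabel 2))) (rootDeltaChar (standardParabolicGL F (lastBlockLabel 2)))))).Coinvariants →ₗ[ℂ] ℂ}
    (hE : ∀ f, E (Representation.Coinvariants.mk _ f) = f.toFun 1)
    (z : (Representation.restrictUnipotentGL F (lastBlockLabel 2) (Representation.smoothIndRep (standardParabolicGL F (lastBlockLabel 2))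
        (Representation.twist (((Representation.trivial ℂ (Π a : Bool, GL {i : Fin 2 // lastBlockLabel 2 i = a} F) ℂ).twist (maxParabolicLeviChar F 2 x y)).comp
          (leviProjection F (lastBlockLabel 2))) (rootDeltaChar (standardParabolicGL F (lastBlockLabel 2)))))).Coinvariants) :
    z ∈ LinearMap.ker E ↔ z ∈ Submodule.map (Representation.Coinvariants.mk (Representation.restrictUnipotentGL F (lastBlockLabel 2)
        (Representation.smoothIndRep (standardParabolicGL F (lastBlockLabel 2))
          (Representation.twist (((Representation.trivial ℂ (Π a : Bool, GL {i : Fin 2 // lastBlockLabel 2 i = a} F) ℂ).twist (maxParabolicLeviChar F 2 x y)).comp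
            (leviProjection F (lastBlockLabel 2))) (rootDeltaChar (standardParabolicGL F (lastBlockLabel 2)))))))
      (vanishingOn (standardParabolicGL F (lastBlockLabel 2)) _ (cellLT (K := F) (lastBlockLabel 2) Fin.revPerm)) := by
  constructor
  · intro hz
    obtain ⟨f, rfl⟩ := Representation.Coinvariants.mk_surjective _ z
    rw [LinearMap.mem_ker, hE] at hz
    exact Submodule.mem_map.2 ⟨f, mem_vanishingOn_of_toFun_one_eq_zero f hz, rfl⟩
  · rintro ⟨f, hf, rfl⟩
    rw [LinearMap.mem_ker, hE]
    refine hf 1 ?_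
    rw [mem_cellLT_rev_iff_apply_eq_zero (n := 0)]
    simp

/-- **A section with `f(1) = 1`** (so `E ≠ 0` and the closed cell contributes the exponent `x ⊠ y`): the section supported on `P · K` for an open subgroup `K ≤ GL₂(𝒪)` on whose
intersection with `P` the datum `σ'_{x,y}` is trivial (`x, y` trivial near `1` ★ `exists_openSubgroup_forall_unitsComplex_eq_one`, `δ^{1/2} = 1` on `P ∩ GL₂(𝒪)` ★
`rootDeltaChar_eq_one_of_mem_of_isClosed_of_isCompact`). [cite: BernsteinZelevinsky1977, §2.3] [cite: Casselman1995, Lemma 7.1.1 (a)] -/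
theorem exists_toFun_one_eq_one (hx : IsOpen (x.ker : Set Fˣ)) (hy : IsOpen (y.ker : Set Fˣ)) :
    ∃ f : Representation.SmoothInd (standardParabolicGL F (lastBlockLabel 2))
        (Representation.twist (((Representation.trivial ℂ (Π a : Bool, GL {i : Fin 2 // lastBlockLabel 2 i = a} F) ℂ).twist (maxParabolicLeviChar F 2 x y)).comp
          (leviProjection F (lastBlockLabel 2))) (rootDeltaChar (standardParabolicGL F (lastBlockLabel 2)))),
      f.toFun 1 = 1 := by
  haveI : IsTopologicalRing F := inferInstance
  haveI : NonarchimedeanGroup (GL (Fin 2) F) := nonarchimedeanGroup_gl F 2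
  set σ' := Representation.twist (((Representation.trivial ℂ (Π a : Bool, GL {i : Fin 2 // lastBlockLabel 2 i = a} F) ℂ).twist (maxParabolicLeviChar F 2 x y)).comp
    (leviProjection F (lastBlockLabel 2))) (rootDeltaChar (standardParabolicGL F (lastBlockLabel 2))) with hσ'
  -- the datum is smooth, so the stabiliser of `1 ∈ ℂ` is an open subgroup of `P`; it contains `P ∩ K` for an open subgroup `K` of `GL₂(F)`
  have hσ's : σ'.IsSmooth := detCharDatum_isSmooth F 2 x y (continuous_unitsCoe_of_isOpen_ker x hx) (continuous_unitsCoe_of_isOpen_ker y hy)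
  have hS : IsOpen ((σ'.stabilizerSubgroup 1 : Subgroup ↥(standardParabolicGL F (lastBlockLabel 2))) : Set ↥(standardParabolicGL F (lastBlockLabel 2))) := hσ's 1
  obtain ⟨O, hO, hOS⟩ := isOpen_induced_iff.1 hS
  have h1O : (1 : GL (Fin 2) F) ∈ O := by
    have h1 : (1 : ↥(standardParabolicGL F (lastBlockLabel 2))) ∈ (Subtype.val ⁻¹' O : Set ↥(standardParabolicGL F (lastBlockLabel 2))) := by
      rw [hOS]
      exact Subgroup.one_mem _
    exact h1
  obtain ⟨K, hK⟩ := NonarchimedeanGroup.is_nonarchimedean O (hO.mem_nhds h1O)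
  have hw : (1 : ℂ) ∈ σ'.fixedPoints ((K : Subgroup (GL (Fin 2) F)).subgroupOf (standardParabolicGL F (lastBlockLabel 2))) := by
    rw [Representation.mem_fixedPoints]
    intro p hp
    have hpS : p ∈ (Subtype.val ⁻¹' O : Set ↥(standardParabolicGL F (lastBlockLabel 2))) := hK (Subgroup.mem_subgroupOf.1 hp)
    rw [hOS] at hpS
    exact (Representation.mem_stabilizerSubgroup _ _ _).1 hpS
  obtain ⟨f, -, hf1, -⟩ := Representation.exists_mem_fixedPoints_toFun_eq_of_isOpen (σ := σ') K.isOpen hw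
  exact ⟨f, hf1⟩

end EvalOne

/-! ## §3  The open-cell part `K₀`: non-zero, stable, and the torus acts by the SWAPPED character `y ⊠ x` -/

section OpenCell

variable (x y : Fˣ →* ℂˣ)

/-- **`K₀ ≠ 0`**: the open Bruhat cell survives in the Jacquet module of `i(x ⊠ y)` (★ `exists_mem_vanishingOn_mk_ne_zero`, the open-cell Haar functional).
[cite: BernsteinZelevinsky1977, Geometrical Lemma 2.12 and Thm. 5.2] [cite: Casselman1995, Lemma 7.1.1 (a)] -/
theorem openCell_ne_bot (hx : IsOpen (x.ker : Set Fˣ)) (hy : IsOpen (y.ker : Set Fˣ)) :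
    Submodule.map (Representation.Coinvariants.mk (Representation.restrictUnipotentGL F (lastBlockLabel 2)
        (Representation.smoothIndRep (standardParabolicGL F (lastBlockLabel 2))
          (Representation.twist (((Representation.trivial ℂ (Π a : Bool, GL {i : Fin 2 // lastBlockLabel 2 i = a} F) ℂ).twist (maxParabolicLeviChar F 2 x y)).comp
            (leviProjection F (lastBlockLabel 2))) (rootDeltaChar (standardParabolicGL F (lastBlockLabel 2)))))))
      (vanishingOn (standardParabolicGL F (lastBlockLabel 2)) _ (cellLT (K := F) (lastBlockLabel 2) Fin.revPerm)) ≠ ⊥ := by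
  obtain ⟨f₀, hf₀, hf₀0⟩ := exists_mem_vanishingOn_mk_ne_zero
    (Representation.twist (((Representation.trivial ℂ (Π a : Bool, GL {i : Fin 2 // lastBlockLabel 2 i = a} F) ℂ).twist (maxParabolicLeviChar F 2 x y)).comp
      (leviProjection F (lastBlockLabel 2))) (rootDeltaChar (standardParabolicGL F (lastBlockLabel 2))))
    (detCharDatum_isSmooth F 2 x y (continuous_unitsCoe_of_isOpen_ker x hx) (continuous_unitsCoe_of_isOpen_ker y hy))
  rw [Submodule.ne_bot_iff]
  exact ⟨_, Submodule.mem_map.2 ⟨f₀, hf₀, rfl⟩, hf₀0⟩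

/-- **`K₀` is stable under the normalised Levi action** (★ `toCoinvariants_apply_mem_of_mem`: `I_open` is `P`-stable). [cite: BernsteinZelevinsky1977, §7.1] -/
theorem normalizedJacquetGL_mem_openCell (m : Π a : Bool, GL {i : Fin 2 // lastBlockLabel 2 i = a} F)
    {z : (Representation.restrictUnipotentGL F (lastBlockLabel 2) (Representation.smoothIndRep (standardParabolicGL F (lastBlockLabel 2))
        (Representation.twist (((Representation.trivial ℂ (Π a : Bool, GL {i : Fin 2 // lastBlockLabel 2 i = a} F) ℂ).twist (maxParabolicLeviChar F 2 x y)).comp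
          (leviProjection F (lastBlockLabel 2))) (rootDeltaChar (standardParabolicGL F (lastBlockLabel 2)))))).Coinvariants}
    (hz : z ∈ Submodule.map (Representation.Coinvariants.mk (Representation.restrictUnipotentGL F (lastBlockLabel 2)
        (Representation.smoothIndRep (standardParabolicGL F (lastBlockLabel 2))
          (Representation.twist (((Representation.trivial ℂ (Π a : Bool, GL {i : Fin 2 // lastBlockLabel 2 i = a} F) ℂ).twist (maxParabolicLeviChar F 2 x y)).comp
            (leviProjection F (lastBlockLabel 2))) (rootDeltaChar (standardParabolicGL F (lastBlockLabel 2)))))))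
      (vanishingOn (standardParabolicGL F (lastBlockLabel 2)) _ (cellLT (K := F) (lastBlockLabel 2) Fin.revPerm))) :
    Representation.normalizedJacquetGL F (lastBlockLabel 2) (Representation.smoothIndRep (standardParabolicGL F (lastBlockLabel 2))
        (Representation.twist (((Representation.trivial ℂ (Π a : Bool, GL {i : Fin 2 // lastBlockLabel 2 i = a} F) ℂ).twist (maxParabolicLeviChar F 2 x y)).comp
          (leviProjection F (lastBlockLabel 2))) (rootDeltaChar (standardParabolicGL F (lastBlockLabel 2))))) m z ∈
      Submodule.map (Representation.Coinvariants.mk (Representation.restrictUnipotentGL F (lastBlockLabel 2)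
        (Representation.smoothIndRep (standardParabolicGL F (lastBlockLabel 2))
          (Representation.twist (((Representation.trivial ℂ (Π a : Bool, GL {i : Fin 2 // lastBlockLabel 2 i = a} F) ℂ).twist (maxParabolicLeviChar F 2 x y)).comp
            (leviProjection F (lastBlockLabel 2))) (rootDeltaChar (standardParabolicGL F (lastBlockLabel 2)))))))
      (vanishingOn (standardParabolicGL F (lastBlockLabel 2)) _ (cellLT (K := F) (lastBlockLabel 2) Fin.revPerm)) := by
  obtain ⟨f, hf, rfl⟩ := Submodule.mem_map.1 hz
  have h := toCoinvariants_apply_mem_of_mem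
    (Representation.twist (((Representation.trivial ℂ (Π a : Bool, GL {i : Fin 2 // lastBlockLabel 2 i = a} F) ℂ).twist (maxParabolicLeviChar F 2 x y)).comp
      (leviProjection F (lastBlockLabel 2))) (rootDeltaChar (standardParabolicGL F (lastBlockLabel 2))))
    (leviEmbeddingP F (lastBlockLabel 2) m) (Submodule.mem_map.2 ⟨f, hf, rfl⟩)
  rw [Representation.toCoinvariants_mk] at h
  rw [Representation.normalizedJacquetGL_mk,
    show blockDiagonalGL F (lastBlockLabel 2) m = ((leviEmbeddingP F (lastBlockLabel 2) m : ↥(standardParabolicGL F (lastBlockLabel 2))) : GL (Fin 2) F) from rfl]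
  exact Submodule.smul_mem _ _ h

set_option maxHeartbeats 400000 in
/-- **THE OPEN-CELL EXPONENT AS A TORUS CHARACTER**: on `K₀` the normalised Levi action of `r_B i(x ⊠ y)` is multiplication by the SWAPPED character `(y ⊠ x)(m)`
— `Q_{1,1}` acts on `K₀` by `σ'_{y,x}` (★ `jacquetData_smul_of_mem`: `U` trivially, scalars by `σ'_{x,y} = σ'_{y,x}`, `d(ϖ)` by `q_F σ'_{x,y}(d₀ ϖ) = σ'_{y,x}(d ϖ)`), and
`r(m) = δ^{-1∕2}(m)·[m·]`, `σ'_{y,x}(m) = δ^{1∕2}(m) (y ⊠ x)(m)`. [cite: BernsteinZelevinsky1977, Thm. 5.2 and §7.1] [cite: Casselman1995, Lemma 7.1.1 (a)] -/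
theorem normalizedJacquetGL_eq_smul_of_mem_openCell (hx : IsOpen (x.ker : Set Fˣ)) (hy : IsOpen (y.ker : Set Fˣ))
    (m : Π a : Bool, GL {i : Fin 2 // lastBlockLabel 2 i = a} F)
    (z : (Representation.restrictUnipotentGL F (lastBlockLabel 2) (Representation.smoothIndRep (standardParabolicGL F (lastBlockLabel 2))
        (Representation.twist (((Representation.trivial ℂ (Π a : Bool, GL {i : Fin 2 // lastBlockLabel 2 i = a} F) ℂ).twist (maxParabolicLeviChar F 2 x y)).comp
          (leviProjection F (lastBlockLabel 2))) (rootDeltaChar (standardParabolicGL F (lastBlockLabel 2)))))).Coinvariants)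
    (hz : z ∈ Submodule.map (Representation.Coinvariants.mk (Representation.restrictUnipotentGL F (lastBlockLabel 2)
        (Representation.smoothIndRep (standardParabolicGL F (lastBlockLabel 2))
          (Representation.twist (((Representation.trivial ℂ (Π a : Bool, GL {i : Fin 2 // lastBlockLabel 2 i = a} F) ℂ).twist (maxParabolicLeviChar F 2 x y)).comp
            (leviProjection F (lastBlockLabel 2))) (rootDeltaChar (standardParabolicGL F (lastBlockLabel 2)))))))
      (vanishingOn (standardParabolicGL F (lastBlockLabel 2)) _ (cellLT (K := F) (lastBlockLabel 2) Fin.revPerm))) :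
    Representation.normalizedJacquetGL F (lastBlockLabel 2) (Representation.smoothIndRep (standardParabolicGL F (lastBlockLabel 2))
        (Representation.twist (((Representation.trivial ℂ (Π a : Bool, GL {i : Fin 2 // lastBlockLabel 2 i = a} F) ℂ).twist (maxParabolicLeviChar F 2 x y)).comp
          (leviProjection F (lastBlockLabel 2))) (rootDeltaChar (standardParabolicGL F (lastBlockLabel 2))))) m z =
      ((maxParabolicLeviChar F 2 y x m : ℂˣ) : ℂ) • z := by
  classical
  revert z
  set σ' := Representation.twist (((Representation.trivial ℂ (Π a : Bool, GL {i : Fin 2 // lastBlockLabel 2 i = a} F) ℂ).twist (maxParabolicLeviChar F 2 x y)).comp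
    (leviProjection F (lastBlockLabel 2))) (rootDeltaChar (standardParabolicGL F (lastBlockLabel 2))) with hσ'def
  set σ'' := Representation.twist (((Representation.trivial ℂ (Π a : Bool, GL {i : Fin 2 // lastBlockLabel 2 i = a} F) ℂ).twist (maxParabolicLeviChar F 2 y x)).comp
    (leviProjection F (lastBlockLabel 2))) (rootDeltaChar (standardParabolicGL F (lastBlockLabel 2))) with hσ''def
  intro z hz
  have hσ' : σ'.IsSmooth := detCharDatum_isSmooth F 2 x y (continuous_unitsCoe_of_isOpen_ker x hx) (continuous_unitsCoe_of_isOpen_ker y hy)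
  -- the hypotheses of ★ `jacquetData_smul_of_mem` for `σ''` (as in ★ `exists_intertwiningMap_swap_ne_zero`)
  have hU'' : ∀ u : ↥(standardParabolicGL F (lastBlockLabel 2)), u ∈ (unipotentRadicalP F (lastBlockLabel 2)) → σ'' u = 1 :=
    fun u hu => detCharDatum_eq_one_of_mem_unipotentRadicalP F 2 y x u hu
  have hz' : ∀ t : Fˣ, σ'' (⟨diagGL (Fin 2) (fun _ => t), diagGL_mem_standardParabolicGL _ _⟩ : ↥(standardParabolicGL F (lastBlockLabel 2))) 1 =
      σ' (⟨diagGL (Fin 2) (fun _ => t), diagGL_mem_standardParabolicGL _ _⟩ : ↥(standardParabolicGL F (lastBlockLabel 2))) 1 := by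
    intro t
    rw [scalar_eq_diag_zero_mul_diag_last, map_mul σ'', map_mul σ', Module.End.mul_apply, Module.End.mul_apply, hσ''def, hσ'def,
      detCharDatum_apply, detCharDatum_apply, detCharDatum_apply, detCharDatum_apply,
      maxParabolicLeviChar_leviProjection_diag_last F (n := 0), maxParabolicLeviChar_leviProjection_diag_zero F (n := 0),
      maxParabolicLeviChar_leviProjection_diag_last F (n := 0), maxParabolicLeviChar_leviProjection_diag_zero F (n := 0)]
    ring
  have hd : ∀ (ϖ : F) (hϖ : IsUniformizingElement ϖ),
      σ'' (⟨diagGL (Fin 2) (Function.update 1 (Fin.last 1) (Units.mk0 ϖ hϖ.ne_zero)), diagGL_mem_standardParabolicGL _ _⟩ : ↥(standardParabolicGL F (lastBlockLabel 2))) 1 =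
        (Literature.NumberTheory.GaloisRepresentations.IsNonarchimedeanLocalField.residueFieldCard F : ℂ) *
          σ' (⟨diagGL (Fin 2) (Function.update 1 0 (Units.mk0 ϖ hϖ.ne_zero)), diagGL_mem_standardParabolicGL _ _⟩ : ↥(standardParabolicGL F (lastBlockLabel 2))) 1 := by
    intro ϖ hϖ
    rw [hσ''def, hσ'def, detCharDatum_diag_last_uniformizer F (n := 0) y x hϖ, residueFieldCard_mul_detCharDatum_diag_zero_uniformizer F (n := 0) x y hϖ,
      zero_add, pow_one]
  -- the Jacquet data of `Ind σ'`
  have hK : ∀ (p : ↥(standardParabolicGL F (lastBlockLabel 2))) (w : (Representation.restrictUnipotentGL F (lastBlockLabel 2)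
      (Representation.smoothIndRep (standardParabolicGL F (lastBlockLabel 2)) σ')).Coinvariants),
      w ∈ Submodule.map (Representation.Coinvariants.mk (Representation.restrictUnipotentGL F (lastBlockLabel 2)
      (Representation.smoothIndRep (standardParabolicGL F (lastBlockLabel 2)) σ'))) (vanishingOn (standardParabolicGL F (lastBlockLabel 2)) σ' (cellLT (K := F) (lastBlockLabel 2) Fin.revPerm)) →
      (Representation.toCoinvariants ((Representation.smoothIndRep (standardParabolicGL F (lastBlockLabel 2)) σ').comp (standardParabolicGL F (lastBlockLabel 2)).subtype)
        (unipotentRadicalP F (lastBlockLabel 2))) p w ∈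
        Submodule.map (Representation.Coinvariants.mk (Representation.restrictUnipotentGL F (lastBlockLabel 2)
      (Representation.smoothIndRep (standardParabolicGL F (lastBlockLabel 2)) σ'))) (vanishingOn (standardParabolicGL F (lastBlockLabel 2)) σ' (cellLT (K := F) (lastBlockLabel 2) Fin.revPerm)) :=
    fun p w hw => toCoinvariants_apply_mem_of_mem σ' p hw
  have hU : ∀ u : ↥(standardParabolicGL F (lastBlockLabel 2)), u ∈ (unipotentRadicalP F (lastBlockLabel 2)) →
      ∀ w : (Representation.restrictUnipotentGL F (lastBlockLabel 2) (Representation.smoothIndRep (standardParabolicGL F (lastBlockLabel 2)) σ')).Coinvariants,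
      (Representation.toCoinvariants ((Representation.smoothIndRep (standardParabolicGL F (lastBlockLabel 2)) σ').comp (standardParabolicGL F (lastBlockLabel 2)).subtype)
        (unipotentRadicalP F (lastBlockLabel 2))) u w = w :=
    toCoinvariants_apply_of_mem_unipotentRadicalP σ'
  have hzJ : ∀ (t : Fˣ) (w : (Representation.restrictUnipotentGL F (lastBlockLabel 2) (Representation.smoothIndRep (standardParabolicGL F (lastBlockLabel 2)) σ')).Coinvariants),
      (Representation.toCoinvariants ((Representation.smoothIndRep (standardParabolicGL F (lastBlockLabel 2)) σ').comp (standardParabolicGL F (lastBlockLabel 2)).subtype)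
        (unipotentRadicalP F (lastBlockLabel 2))) (⟨diagGL (Fin 2) (fun _ => t), diagGL_mem_standardParabolicGL _ _⟩ : ↥(standardParabolicGL F (lastBlockLabel 2))) w =
        σ'' (⟨diagGL (Fin 2) (fun _ => t), diagGL_mem_standardParabolicGL _ _⟩ : ↥(standardParabolicGL F (lastBlockLabel 2))) 1 • w := fun t w => by
    rw [hz' t]
    exact toCoinvariants_scalar_apply σ' t w
  have hunif : ∀ (ϖ : F) (hϖ : IsUniformizingElement ϖ)
      (w : (Representation.restrictUnipotentGL F (lastBlockLabel 2) (Representation.smoothIndRep (standardParabolicGL F (lastBlockLabel 2)) σ')).Coinvariants),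
      w ∈ Submodule.map (Representation.Coinvariants.mk (Representation.restrictUnipotentGL F (lastBlockLabel 2)
      (Representation.smoothIndRep (standardParabolicGL F (lastBlockLabel 2)) σ'))) (vanishingOn (standardParabolicGL F (lastBlockLabel 2)) σ' (cellLT (K := F) (lastBlockLabel 2) Fin.revPerm)) →
      (Representation.toCoinvariants ((Representation.smoothIndRep (standardParabolicGL F (lastBlockLabel 2)) σ').comp (standardParabolicGL F (lastBlockLabel 2)).subtype)
        (unipotentRadicalP F (lastBlockLabel 2)))
          (⟨diagGL (Fin 2) (Function.update 1 (Fin.last 1) (Units.mk0 ϖ hϖ.ne_zero)), diagGL_mem_standardParabolicGL _ _⟩ : ↥(standardParabolicGL F (lastBlockLabel 2))) w =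
        σ'' (⟨diagGL (Fin 2) (Function.update 1 (Fin.last 1) (Units.mk0 ϖ hϖ.ne_zero)), diagGL_mem_standardParabolicGL _ _⟩ : ↥(standardParabolicGL F (lastBlockLabel 2))) 1 • w :=
    fun ϖ hϖ w hw => by
      rw [hd ϖ hϖ]
      exact toCoinvariants_diag_uniformizer_apply_of_mem σ' hσ' hϖ w hw
  have hzK : z ∈ Submodule.map (Representation.Coinvariants.mk (Representation.restrictUnipotentGL F (lastBlockLabel 2)
      (Representation.smoothIndRep (standardParabolicGL F (lastBlockLabel 2)) σ')))
      (vanishingOn (standardParabolicGL F (lastBlockLabel 2)) σ' (cellLT (K := F) (lastBlockLabel 2) Fin.revPerm)) := hz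
  have key := jacquetData_smul_of_mem σ''
    (Representation.toCoinvariants ((Representation.smoothIndRep (standardParabolicGL F (lastBlockLabel 2)) σ').comp (standardParabolicGL F (lastBlockLabel 2)).subtype)
      (unipotentRadicalP F (lastBlockLabel 2)))
    (Submodule.map (Representation.Coinvariants.mk (Representation.restrictUnipotentGL F (lastBlockLabel 2)
      (Representation.smoothIndRep (standardParabolicGL F (lastBlockLabel 2)) σ')))
      (vanishingOn (standardParabolicGL F (lastBlockLabel 2)) σ' (cellLT (K := F) (lastBlockLabel 2) Fin.revPerm)))
    hK hU hU'' hzJ hunif (leviEmbeddingP F (lastBlockLabel 2) m) z hzK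
  -- read `r(m)` through the `P`-action
  obtain ⟨f, rfl⟩ := Representation.Coinvariants.mk_surjective _ z
  rw [Representation.toCoinvariants_mk] at key
  have key' : Representation.Coinvariants.mk (Representation.restrictUnipotentGL F (lastBlockLabel 2)
      (Representation.smoothIndRep (standardParabolicGL F (lastBlockLabel 2)) σ'))
        (Representation.smoothIndRep (standardParabolicGL F (lastBlockLabel 2)) σ'
          ((leviEmbeddingP F (lastBlockLabel 2) m : ↥(standardParabolicGL F (lastBlockLabel 2))) : GL (Fin 2) F) f) =
      σ'' (leviEmbeddingP F (lastBlockLabel 2) m) 1 •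
        Representation.Coinvariants.mk (Representation.restrictUnipotentGL F (lastBlockLabel 2)
          (Representation.smoothIndRep (standardParabolicGL F (lastBlockLabel 2)) σ')) f := key
  have hscal : (((rootDeltaChar (standardParabolicGL F (lastBlockLabel 2)) (leviEmbeddingP F (lastBlockLabel 2) m))⁻¹ : ℂˣ) : ℂ) *
      σ'' (leviEmbeddingP F (lastBlockLabel 2) m) 1 = ((maxParabolicLeviChar F 2 y x m : ℂˣ) : ℂ) := by
    rw [hσ''def, detCharDatum_apply, leviProjection_leviEmbeddingP_apply, mul_one, ← mul_assoc, ← Units.val_mul, inv_mul_cancel,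
      Units.val_one, one_mul]
  rw [Representation.normalizedJacquetGL_mk,
    show blockDiagonalGL F (lastBlockLabel 2) m = ((leviEmbeddingP F (lastBlockLabel 2) m : ↥(standardParabolicGL F (lastBlockLabel 2))) : GL (Fin 2) F) from rfl,
    key', smul_smul, hscal]

end OpenCell


end Summit.HodgeConjecture.HodgeConjecture.Cruxes.H413.K2E3GL2JacquetModuleStructure

end
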